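import Summits.BirchSwinnertonDyer.BirchSwinnertonDyer.Theorems.ManinLocalTwoThreeSymbolHeckeDictionary
import Summits.BirchSwinnertonDyer.BirchSwinnertonDyer.Theorems.ManinLocalTwoThreeDefs
import Literature.NumberTheory.EllipticCurves.ModularSymbolsPStabilisation
import HarnessLib

/-!
# The dictionary over the route's `symbolHecke` / `symbolShift` (p2's Defs): level-independence of `T_r`, `δ ∘ T_r = T_r ∘ δ`,
# and `T_r` COMMUTES with the level shift `Φ ↦ Φ∘diag(d,1)` for `r ∤ d` (MEMO-es §22.2–§23.4, p3 dictionary part 2)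

Summit `BirchSwinnertonDyer`, route `ManinLocalTwoThree` (cell bsd-f2-manin), cruxes C2 `ManinOddAtFour`
(stmt-BirchSwinnertonDyer-22967) / C3 `ManinPrimeToThreeAtNine` (stmt-BirchSwinnertonDyer-22968); registered stubs
`stub_relativeIharaBarTwo` / `stub_relativeIharaBar331` = leaf E-es-25 ⟸ E-es-35 `ShiftInvariantIsDiamond` (p3
`relativeIharaShiftVanishingBar_of_shiftInvariantIsDiamond`).  In the proof of E-es-35 (MEMO-es §23.2) the lifted cusp symbol
`Φ` is made `A_tⁿ`-invariant by applying Hecke polynomials `q_r(T_r)` that fix the class `u` and kill the boundary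
discrepancy `Φ∘A − Φ`; this needs `T_r` to commute with the boundary map `δ` (part 1,
`Theorems/ManinLocalTwoThreeSymbolHeckeDictionary.lean`, binder-side representatives) AND WITH THE SHIFT `Φ ↦ Φ∘A`.  Here, over
the route's definitions `symbolHecke N r K` (p2, `Theorems/ManinLocalTwoThreeDefs.lean`, representatives `heckeRepGL r` indexed
by the tree's `HeckeIdx N r`) and `symbolShift K (A • ·)`:

* `symbolHecke_eq_of_not_dvd` — `symbolHecke N r K = symbolHecke N' r K` whenever `r ∤ N`, `r ∤ N'` (the index sets are
  both `Option (ZMod r)`: the operator does not depend on the level used to index it);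
* `symbolHecke_invariant`, `delta_symbolHecke_eq_heckeU` — part 1 instantiated: `T_r` preserves `Γ₀(L)`-invariance and
  `δ(T_r Φ) = heckeU 0 L K hr (δΦ)` for `Γ₀(L)`-invariant additive `Φ`;
* `diagShift_invariant` — `Φ∘A` is `Γ₀(L')`-invariant for `L d ∣ L'` (part 1 `shift_cuspSymbol_invariant`);
* **`symbolHecke_diagShift_comm`** — for a prime `r ∤ d` and `Φ` invariant under `Γ₀(M)` (any `M`; only the translations
  `(1 k; 0 1)` are used): `T_r (Φ∘A) = (T_r Φ)∘A`, `A = diag(d, 1)`.  Proof: `A·β_j = T^k · β_{dj} · A` with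
  `T^k = (1 k; 0 1) ∈ Γ₀(M)`, `k = (d j − (dj mod r))/r` (`diag_mul_heckeRepGL_some`), `A·β_∞ = β_∞·A`, and reindexing by
  the bijection `j ↦ d j` of `ℤ/r` (`d` is a unit mod `r`).

Nothing here is specific to elliptic curves; nothing about BSD or Manin's conjecture is proved by this file.

References: HOME/MEMO-es.md §22.2, §23.2–23.4 (cell bsd-f2-manin); [Shimura1971] §8.3 (8.3.2); [DiamondShurman2005] §5.2.
-/

set_option autoImplicit false
set_option linter.dupNamespace false

open scoped MatrixGroups

open CongruenceSubgroup Matrix.SpecialLinearGroup Literature.NumberTheory.EllipticCurves.ModularForms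
  Literature.NumberTheory.EllipticCurves.ModularForms.HidaCohomology

namespace Summit.BirchSwinnertonDyer.BirchSwinnertonDyer.Theorems.ManinLocalTwoThree

noncomputable section

/-! ### §1  Level-independence of the indexed Hecke operator -/

section Reindex

variable {r : ℕ} [NeZero r] (K : Type*) [CommRing K]


/-- **`symbolHecke` does not depend on the indexing level**: `symbolHecke N r K = symbolHecke N' r K` for `r ∤ N`, `r ∤ N'`.
[folklore] -/
theorem symbolHecke_eq_of_not_dvd {N N' : ℕ} (hN : ¬ r ∣ N) (hN' : ¬ r ∣ N') :
    symbolHecke N r K = symbolHecke N' r K := by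
  apply LinearMap.ext
  intro Φ
  funext a b
  rw [symbolHecke_apply, symbolHecke_apply]
  let e : HeckeIdx N r ≃ HeckeIdx N' r :=
    (Equiv.refl (Option (ZMod r))).subtypeEquiv (fun o => by
      constructor
      · intro _ ho; exact hN'
      · intro _ ho; exact hN)
  exact Fintype.sum_equiv e _ _ (fun i => rfl)

/-- The same for `cuspFunHecke`. [folklore] -/
theorem cuspFunHecke_eq_of_not_dvd {N N' : ℕ} (hN : ¬ r ∣ N) (hN' : ¬ r ∣ N') :
    cuspFunHecke N r K = cuspFunHecke N' r K := by
  apply LinearMap.ext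
  intro w
  funext x
  rw [cuspFunHecke_apply, cuspFunHecke_apply]
  let e : HeckeIdx N r ≃ HeckeIdx N' r :=
    (Equiv.refl (Option (ZMod r))).subtypeEquiv (fun o => by
      constructor
      · intro _ ho; exact hN'
      · intro _ ho; exact hN)
  exact Fintype.sum_equiv e _ _ (fun i => rfl)

end Reindex

/-! ### §2  Part 1 instantiated on `symbolHecke` -/

section Instantiate

variable {L : ℕ} {K : Type*} [CommRing K] {r : ℕ} [NeZero r] (hr : r.Prime) (Φ : OnePoint ℚ → OnePoint ℚ → K)

include hr

/-- **`T_r` preserves `Γ₀(L)`-invariance** (`symbolHecke L r K`). [folklore] -/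
theorem symbolHecke_invariant
    (hinv : ∀ γ : Gamma0 L, ∀ a b, Φ (mapGL ℚ (γ : SL(2, ℤ)) • a) (mapGL ℚ (γ : SL(2, ℤ)) • b) = Φ a b)
    (γ : Gamma0 L) (a b : OnePoint ℚ) :
    symbolHecke L r K Φ (mapGL ℚ (γ : SL(2, ℤ)) • a) (mapGL ℚ (γ : SL(2, ℤ)) • b) = symbolHecke L r K Φ a b := by
  rw [symbolHecke_apply, symbolHecke_apply]
  exact hecke_cuspSymbol_invariant hr (fun i : HeckeIdx L r => heckeRepGL r i.1) (fun i => coe_heckeRepGL r i.1) Φ hinv γ a b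

/-- **`δ(T_r Φ) = heckeU 0 L K hr (δΦ)`** for a `Γ₀(L)`-invariant additive symbol (`symbolHecke L r K`). [folklore] -/
theorem delta_symbolHecke_eq_heckeU (hsym : ∀ a b c, Φ a b + Φ b c = Φ a c)
    (hinv : ∀ γ : Gamma0 L, ∀ a b, Φ (mapGL ℚ (γ : SL(2, ℤ)) • a) (mapGL ℚ (γ : SL(2, ℤ)) • b) = Φ a b) :
    (fun (γ : Gamma0 L) (_ : Fin 1) => symbolHecke L r K Φ OnePoint.infty (mapGL ℚ (γ : SL(2, ℤ)) • OnePoint.infty)) =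
      heckeU 0 L K hr (fun (γ : Gamma0 L) (_ : Fin 1) => Φ OnePoint.infty (mapGL ℚ (γ : SL(2, ℤ)) • OnePoint.infty)) := by
  rw [← delta_hecke_cuspSymbol_eq_heckeU hr (fun i : HeckeIdx L r => heckeRepGL r i.1) (fun i => coe_heckeRepGL r i.1) Φ
    hsym hinv]
  funext γ k
  rw [symbolHecke_apply]

end Instantiate

section ShiftInstantiate

variable {L L' d : ℕ} [NeZero d] (h : L * d ∣ L') {K : Type*} [CommRing K]
  (A : GL (Fin 2) ℚ) (hA : (A : Matrix (Fin 2) (Fin 2) ℚ) = !![(d : ℚ), 0; 0, 1]) (Φ : OnePoint ℚ → OnePoint ℚ → K)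

include h hA

/-- **`Φ∘A` is `Γ₀(L')`-invariant** for `Γ₀(L)`-invariant `Φ`, `L d ∣ L'` (`symbolShift K (A • ·)`). [folklore] -/
theorem diagShift_invariant
    (hinv : ∀ γ : Gamma0 L, ∀ a b, Φ (mapGL ℚ (γ : SL(2, ℤ)) • a) (mapGL ℚ (γ : SL(2, ℤ)) • b) = Φ a b)
    (γ : Gamma0 L') (a b : OnePoint ℚ) :
    symbolShift K (fun x => A • x) Φ (mapGL ℚ (γ : SL(2, ℤ)) • a) (mapGL ℚ (γ : SL(2, ℤ)) • b) =
      symbolShift K (fun x => A • x) Φ a b := by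
  rw [symbolShift_apply, symbolShift_apply]
  exact shift_cuspSymbol_invariant h A hA Φ hinv γ a b

end ShiftInstantiate

/-! ### §3  `T_r` commutes with the shift `Φ ↦ Φ∘diag(d,1)` for `r ∤ d` -/

section Commute

variable {r d : ℕ} [NeZero r] (A : GL (Fin 2) ℚ) (hA : (A : Matrix (Fin 2) (Fin 2) ℚ) = !![(d : ℚ), 0; 0, 1])

include hA

/-- `A · β_∞ = β_∞ · A` (both diagonal). [folklore] -/
theorem diag_mul_heckeRepGL_none : A * heckeRepGL r none = heckeRepGL r none * A := by
  apply Units.ext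
  rw [Units.val_mul, Units.val_mul, hA, coe_heckeRepGL]
  have e : heckeRep r none = !![(r : ℤ), 0; 0, 1] := rfl
  rw [e]
  ext i k
  fin_cases i <;> fin_cases k <;> simp [Matrix.mul_apply, Fin.sum_univ_two, mul_comm]

/-- **`A · β_j = T^k · β_{dj} · A`** with `T^k = (1 k; 0 1)`, `k = (d·j − (dj mod r))/r` — the shift permutes the finite
Hecke representatives up to left translations (no hypothesis on `r`, `d`). [folklore] -/
theorem diag_mul_heckeRepGL_some (j : ZMod r) :
    ∃ k : ℤ, A * heckeRepGL r (some j) =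
      mapGL ℚ (ModularGroup.T ^ k) * heckeRepGL r (some ((d : ZMod r) * j)) * A := by
  set j' : ZMod r := (d : ZMod r) * j with hj'
  have hdvd : (r : ℤ) ∣ (d : ℤ) * (j.val : ℤ) - (j'.val : ℤ) := by
    rw [← ZMod.intCast_zmod_eq_zero_iff_dvd]
    push_cast
    rw [ZMod.natCast_zmod_val, ZMod.natCast_zmod_val, hj', sub_self]
  obtain ⟨k, hk⟩ := hdvd
  refine ⟨k, ?_⟩
  have hk' : (d : ℚ) * (ZMod.cast j : ℚ) = (ZMod.cast j' : ℚ) + (k : ℚ) * (r : ℚ) := by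
    have h1 := congrArg (fun z : ℤ => (z : ℚ)) hk
    push_cast at h1
    rw [ZMod.natCast_val, ZMod.natCast_val] at h1
    linear_combination h1
  apply Units.ext
  rw [Units.val_mul, Units.val_mul, Units.val_mul, hA, coe_heckeRepGL, coe_heckeRepGL, coe_mapGL_eq_map,
    ModularGroup.coe_T_zpow]
  have e1 : heckeRep r (some j) = !![1, (j.val : ℤ); 0, (r : ℤ)] := rfl
  have e2 : heckeRep r (some j') = !![1, (j'.val : ℤ); 0, (r : ℤ)] := rfl
  rw [e1, e2]
  ext i l
  fin_cases i <;> fin_cases l <;> simp [Matrix.mul_apply, Fin.sum_univ_two, hk']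

variable (hr : r.Prime) (hrd : ¬ r ∣ d) {K : Type*} [CommRing K] {M N : ℕ} (Φ : OnePoint ℚ → OnePoint ℚ → K)
include hr hrd

/-- **`T_r` commutes with the shift**: for a prime `r ∤ d`, `A = diag(d,1)` and `Φ` invariant under `Γ₀(M)` (any `M`),
`T_r (Φ∘A) = (T_r Φ)∘A`, i.e. `Σ_i Φ(Aβ_i a, Aβ_i b) = Σ_i Φ(β_i A a, β_i A b)`.  MEMO-es §22.2 («`T_r` commutes with
`Φ ↦ Φ|A` for `r ≠ t`»). [folklore] -/
theorem symbolHecke_diagShift_comm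
    (hinv : ∀ γ : Gamma0 M, ∀ a b, Φ (mapGL ℚ (γ : SL(2, ℤ)) • a) (mapGL ℚ (γ : SL(2, ℤ)) • b) = Φ a b) :
    symbolHecke N r K (symbolShift K (fun x => A • x) Φ) = symbolShift K (fun x => A • x) (symbolHecke N r K Φ) := by
  haveI : Fact r.Prime := ⟨hr⟩
  -- the unit `d mod r` and the induced permutation of the index set
  have hcop : Nat.Coprime d r := (Nat.coprime_comm.mp ((Nat.Prime.coprime_iff_not_dvd hr).2 hrd))
  let u : (ZMod r)ˣ := ZMod.unitOfCoprime d hcop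
  have hu : (u : ZMod r) = (d : ZMod r) := ZMod.coe_unitOfCoprime d hcop
  let eo : Option (ZMod r) ≃ Option (ZMod r) := Equiv.optionCongr u.mulLeft
  have heo_none : eo none = none := rfl
  have heo_some : ∀ j : ZMod r, eo (some j) = some ((d : ZMod r) * j) := fun j => by
    show Option.map _ (some j) = _
    rw [Option.map_some, Units.mulLeft_apply, hu]
  let e : HeckeIdx N r ≃ HeckeIdx N r := eo.subtypeEquiv (fun o => by
    cases o with
    | none => rw [heo_none]
    | some j => rw [heo_some]; simp)
  funext a b
  rw [symbolHecke_apply, symbolShift_apply, symbolHecke_apply]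
  simp only [symbolShift_apply]
  -- termwise: `Φ(Aβ_o a, Aβ_o b) = Φ(β_{e o} A a, β_{e o} A b)`
  refine Fintype.sum_equiv e _ _ (fun i => ?_)
  obtain ⟨o, ho⟩ := i
  cases o with
  | none =>
    show Φ (A • heckeRepGL r none • a) (A • heckeRepGL r none • b) =
      Φ (heckeRepGL r none • A • a) (heckeRepGL r none • A • b)
    rw [← mul_smul, ← mul_smul, diag_mul_heckeRepGL_none A hA, mul_smul, mul_smul]
  | some j =>
    show Φ (A • heckeRepGL r (some j) • a) (A • heckeRepGL r (some j) • b) =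
      Φ (heckeRepGL r (some ((d : ZMod r) * j)) • A • a) (heckeRepGL r (some ((d : ZMod r) * j)) • A • b)
    obtain ⟨k, hk⟩ := diag_mul_heckeRepGL_some A hA j
    rw [← mul_smul, ← mul_smul, hk, mul_smul, mul_smul, mul_smul, mul_smul]
    exact hinv ⟨ModularGroup.T ^ k, Literature.NumberTheory.EllipticCurves.CoeffActionOn.T_zpow_mem_gamma0 M k⟩ _ _

end Commute

end

end Summit.BirchSwinnertonDyer.BirchSwinnertonDyer.Theorems.ManinLocalTwoThree
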